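import Literature.MathematicalPhysics.QuantumFieldTheory.Balaban1983to89.GaussianSmallField
import Literature.Probability.Distributions.KhatriSidak
import HarnessLib

/-!
# `Balaban1983to89.GaussianSmallFieldSidak` — Šidák's inequality [Sidak1967] DISCHARGED: the named fact
`GaussianSmallField.SidakInequality` is a theorem, and the small-field Gaussian box bound holds unconditionally

statement-level skeleton of published theorems with citation tags; proofs where landed; nothing here is a claim about the Yang–Mills mass gap

PDF held: Z. Šidák, J. Amer. Statist. Assoc. 62 (1967) 626–633 is NOT held; the proof followed is the printed one of
E. Giné, R. Nickl, *Mathematical Foundations of Infinite-Dimensional Statistical Models* [GineNickl2021] §2.4.1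
(held: `book:gine2021-mathematical-foundations-infinite-dimensional-statistical-models`, chunks p0109–p0113, p0121):
Thm 2.4.2 (Prékopa–Leindler, tree `Literature.Analysis.Convexity.PrekopaLeindler`) → Thm 2.4.3 (log-concavity of
Gaussian measures) → Thm 2.4.4 / Exercise 2.4.5 (Anderson's lemma) → Exercise 2.4.6 + Corollary 2.4.6 (Khatri–Šidák)
→ "iterating" = Šidák's Corollary 1 — all PROVED in `Literature.Probability.Distributions.KhatriSidak` (this seat).

WHAT IS REPRODUCED.  `sidakInequality_holds : GaussianSmallField.SidakInequality` (also under the canonical discharge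
name `GaussianSmallField.SidakInequality_holds`): for every `k`, every real `k × k` matrix `S` and thresholds `pᵢ`,
`∏ᵢ P_{N(0,S)}(|xᵢ| ≤ pᵢ) ≤ P_{N(0,S)}(|xᵢ| ≤ pᵢ ∀ i)` for Mathlib's `multivariateGaussian 0 S` — the fact as typed
(its hypotheses `S.PosSemidef`, `0 < pᵢ` are not even needed).  This was the ONE cited hypothesis (`hSidak`) of the
small-field Gaussian volume kernels of the B10 rows (22), (37), (47): `GaussianSmallField.smallFieldBox_real_ge_sites`,
`T4TerritoryReflection.smallFieldBox_real_ge` (whose `SidakInequality` is an `abbrev` of the same fact, so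
`sidakInequality_holds` feeds it verbatim) and `B10Eq47Volume.ballEvent_real_ge` / `volume47_real_ge` /
`log_volume47_ge` / `volume47_real_ge_sites` / `volumeLinear_real_ge` — each becomes unconditional by passing
`GaussianSmallFieldSidak.sidakInequality_holds` for `hSidak`; `smallFieldBox_real_ge_sites` below is the
hypothesis-free form of the Mathlib-only one (the others are not restated here to keep this file's import cone at
`GaussianSmallField` + `KhatriSidak`).  No definition, no named fact, no `sorry`; axioms ⊆ {propext,
Classical.choice, Quot.sound}.  Unit `lit-balaban-p24` (gen 5, EXT:Sidak1967), HOME `run/shared/lean/pub/lit-balaban/`.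
-/

noncomputable section

open MeasureTheory ProbabilityTheory

namespace Literature.MathematicalPhysics.QuantumFieldTheory.Balaban1983to89.GaussianSmallFieldSidak

open Literature.MathematicalPhysics.QuantumFieldTheory.Balaban1983to89

/-- **ŠIDÁK'S INEQUALITY HOLDS** — the named fact `GaussianSmallField.SidakInequality` ([Sidak1967] Corollary 1 as
quoted in [SchechtmanSchlumprechtZinn1998] p. 347; [GineNickl2021] Cor. 2.4.6) DISCHARGED from the Khatri–Šidák
inequality proved in `Literature.Probability.Distributions.KhatriSidak` (Prékopa–Leindler → log-concavity of the
Gaussian measure of sections → Anderson → Khatri–Šidák → iteration). [cite: Sidak1967, Corollary 1] -/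
theorem sidakInequality_holds : GaussianSmallField.SidakInequality :=
  fun _k S _hS p _hp => Literature.Probability.Distributions.KhatriSidak.sidak_multivariateGaussian_real S p

/-- **THE SMALL-FIELD MASS OF THE BOX WITH PER-SITE THRESHOLDS, UNCONDITIONALLY**:
`GaussianSmallField.smallFieldBox_real_ge_sites` with its Šidák hypothesis discharged — for a positive semidefinite
covariance `S` on `k` sites with `S i i ≤ C i`, thresholds `p i > 0` in the regime `2e^{−pᵢ²/(2Cᵢ)} ≤ ½`:
`exp(−2 Σᵢ 2e^{−pᵢ²/(2Cᵢ)}) ≤ P_{N(0,S)}(|xᵢ| ≤ pᵢ ∀ i)`. [cite: Sidak1967, Corollary 1] -/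
theorem smallFieldBox_real_ge_sites {k : ℕ} {S : Matrix (Fin k) (Fin k) ℝ} (hS : S.PosSemidef)
    {C p : Fin k → ℝ} (hC : ∀ i, 0 < C i) (hSC : ∀ i, S i i ≤ C i) (hp : ∀ i, 0 < p i)
    (hsmall : ∀ i, 2 * Real.exp (-(p i ^ 2 / (2 * C i))) ≤ 1 / 2) :
    Real.exp (-(2 * ∑ i, 2 * Real.exp (-(p i ^ 2 / (2 * C i))))) ≤
      (multivariateGaussian 0 S).real {x | ∀ i, |x i| ≤ p i} :=
  GaussianSmallField.smallFieldBox_real_ge_sites sidakInequality_holds hS hC hSC hp hsmall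

end Literature.MathematicalPhysics.QuantumFieldTheory.Balaban1983to89.GaussianSmallFieldSidak

namespace Literature.MathematicalPhysics.QuantumFieldTheory.Balaban1983to89.GaussianSmallField

/-- **Canonical discharge name** of the named fact `GaussianSmallField.SidakInequality` (`X` ↦ `X_holds`), an alias of
`GaussianSmallFieldSidak.sidakInequality_holds` placed next to the fact's name so that `(h : SidakInequality)` binders
are fed `SidakInequality_holds`. [cite: Sidak1967, Corollary 1] -/
theorem SidakInequality_holds : SidakInequality := GaussianSmallFieldSidak.sidakInequality_holds

end Literature.MathematicalPhysics.QuantumFieldTheory.Balaban1983to89.GaussianSmallField
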